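import Mathlib.Analysis.Normed.Lp.Matrix
import Mathlib.LinearAlgebra.Matrix.NonsingularInverse
import Literature.Analysis.FluidPDE.BoltzmannGradLimit
import HarnessLib

/-!
# Objective (Dayal–James) molecular dynamics of hard spheres in a homogeneously deforming periodic cell

Definition item `defn-ObjectiveHardSphereFlow` (topic `Literature/Analysis/FluidPDE`, next to
`HardSphereDynamics`), wanted by the route `HomoenergeticRung` of `AtomisticToContinuum /
HydrodynamicLimit` (decls `HomoenergeticAdiabat`, `OneTensorBalance`, `PassiveHeating`).

**The model (Dayal–James 2010, §3–4; restated in James–Nota–Velázquez 2019, §1).** Fix a matrix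
`A ∈ M_d(ℝ)` and the *deformation gradient* `F_t = I + tA`. `N` hard spheres of diameter `ε`
("simulated atoms") move in `ℝᵈ` together with all their periodic images: the image `n ∈ ℤᵈ` of
particle `j` sits at `x_j + F_t n` and has velocity `v_j + A n` (JNV 2019 §1, eq. for
`y_{ν,k}(t) = y_k(t) + (I+tA)ν`). Between contacts every particle and image moves freely; when
particle `i` touches an image of particle `j` (`|x_i - x_j - F_t n| = ε`) the pair collides
elastically with the relative velocity `w = v_i - v_j - A n` of particle and IMAGE. By frame
indifference the image-symmetric configuration is an exact invariant manifold of Newtonian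
hard-sphere dynamics of the infinite system (Dayal–James §3): this is periodic MD in the deforming
cell `ℝᵈ/F_t ℤᵈ`, realising the homoenergetic (affine) flow `u(t, x) = A F_t⁻¹ x` with density
`∝ 1/det F_t`, for `t` in the maximal interval around `0` on which `det F_t > 0`
(`Objective.timeInterval`; `t*(A)` = its right end point).

**Coordinates used here (SLLOD / cell coordinates; Evans–Morriss 2008 Ch. 6 for the name).** We
describe a particle by its CELL POSITION `q = F_t⁻¹ x ∈ 𝕋ᵈ = UnitAddTorus d` and its PECULIAR
VELOCITY `c = v - A F_t⁻¹ x ∈ ℝᵈ` (velocity relative to the affine field). All images of a particle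
have the same `(q, c)`, so the `N`-particle phase space is literally the torus phase space
`Config N d (UnitAddTorus d)` of `HardSpherePhaseSpace` — the same type on which the conjunct
`HydrodynamicLimit` lives, so `empiricalMeasure`, `Config.vel`, … apply verbatim and the
"empirical kinetic tensor" of a configuration IS the peculiar kinetic tensor. In these
coordinates (elementary calculus from the formulas above, recorded as the definitions below):

* free flight from time `s` to time `t` is the explicit affine map
  `(q, c) ↦ (q + (t - s) F_t⁻¹ c, F_s F_t⁻¹ c)` (`Objective.freeFlight`; so `ċ = -B_t c` with the
  Eulerian velocity gradient `B_t = A F_t⁻¹`, and `q̇ = F_t⁻¹ c`);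
* the physical separation vectors of particle `i` from the images of particle `j` are
  `F_t (r + n)`, `n ∈ ℤᵈ`, where `r = Torus.reprSym (q_i - q_j)` (`Objective.imageSepVec`); the
  hard-sphere constraint at time `t` is `ε ≤ |F_t (r + n)|` for all `(i, j, n)` with `i ≠ j` or
  `n ≠ 0` — ALL images, including a particle's own (`Objective.domain`; the constraint is honestly
  time dependent: the cell deforms);
* the physical relative velocity of `i` and the image of `j` at separation `s = F_t (r + n)` is
  `w = c_i - c_j + B_t s` (`Objective.relVel`: the image offset `A n` is invisible in `c` but
  reappears through `B_t s`), and the elastic jump changes `(c_i, c_j)` by `∓ (⟪w, s⟫/|s|²) s`,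
  positions unchanged (`Objective.collide`, written with `reflectVel` of `HardSpherePhaseSpace`);
* Lebesgue measure `dx dv` of the simulated atoms corresponds to `(det F_t)^N dq dc`; the
  invariant family of Liouville measures is `Objective.liouville A ε N t =
  (det F_t)^N • volume|_{domain at t}`, and the flow maps `Φ_{s,t}` push the time-`s` measure
  to the time-`t` measure (Liouville's theorem; Dayal–James §4 / the moving-image frame argument).

The Lagrangian labels `(g, v) = (x - t v, v)` modulo the static lattice `{(n, A n)}` of the route
file are the time-`0` free-flight labels `(q - t c, F_t c)` of `(q, c)`; we do not introduce them
separately.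

**Contents.**
* kinematics: `Objective.defGrad`, `Objective.velGrad`, `Objective.timeInterval`,
  `Objective.imageSepVec`, `Objective.relVel`, `Objective.domain`, `Objective.contactSet`,
  `Objective.IsIncoming`, `Objective.freeFlight`, `Objective.collide`, `Objective.collisionTimes`,
  `Objective.liouville`;
* `IsObjectiveHSTrajectory A ε N T γ` — hard-sphere trajectory of the objective dynamics on the
  time window `[0, T]` (right-continuous bookkeeping of `IsHardSphereTrajectory`: locally finite
  collision times, continuous positions, free flight between collisions, and at each collision
  time exactly ONE contact `(i, j, n)` from a pre-collisional left limit, elastic jump);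
* `ObjectiveHardSphereFlow A ε N T` — the HYPOTHESIS STRUCTURE (as `HardSphereFlow`): two-time flow
  maps `Φ s t` on `[0, T]`, measurable conull good sets `good t ⊆ domain t`, `Φ s s = id`, the
  cocycle `Φ t u ∘ Φ s t = Φ s u`, measurability, orbits are objective trajectories, and
  `Φ s t` pushes `liouville s` to `liouville t`; API `lawAt`, `flow_flow_symm`, the inhabitant
  `zero` (`N = 0`). EXISTENCE is NOT a field: `ObjectiveHardSphereFlow.Existence A ε N T` names the
  Alexander-type statement (see below);
* data and observables: `objectiveGibbsDensity` / `objectiveGibbsLaw A ε N θ₀` (canonical Gibbs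
  datum at time `0`: uniform non-overlapping cell positions × Maxwellian peculiar velocities at
  temperature `θ₀`, i.e. lab velocities Maxwellian about `u = A x`), `empiricalKineticTensor`
  (`N⁻¹ ∑ᵢ cᵢ ⊗ cᵢ`, with `empiricalKineticTensor_eq_integral` linking it to `empiricalMeasure`),
  `empiricalTemperature`.
* `A = 0` sanity lemmas: `Objective.freeFlight_zero_matrix`, `Objective.collide_zero_matrix`,
  `Objective.isIncoming_zero_matrix_iff` — at `A = 0` the kinematics is literally that of
  `HardSpherePhaseSpace` on `Torus.geometry d`.

**Design notes.**
* Why not an instance of `HardSphereFlow` over some `Geometry`: image copies carry velocity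
  offsets `A n` that `collidePair`/`reflectVel` applied to `(c_i, c_j)` cannot see, free flight is
  not a translation action of `ℝᵈ` (velocities change), and the domain and Liouville measure are
  time dependent; so the structure is two-time (`Φ s t`) with time-indexed good sets/measures.
* The time window `[0, T]` is a parameter: for `N ≥ 1` no inhabitant can exist past the time
  where the cell becomes too thin (`|F_t n| < ε` for some `n ≠ 0`: `domain = ∅`) — in particular
  not up to `t*(A)` in general — so quantifying the dynamics over the whole of `timeInterval A`
  would make the structure vacuous. Statements take `T` with `Icc 0 T ⊆ timeInterval A`.
* Existence (an Alexander-type theorem: for a.e. datum the dynamics has locally finitely many,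
  binary, non-grazing collisions) is NOT in print for deforming cells (Dayal–James prove the
  invariant-manifold property for smooth forces under standard ODE well-posedness; Alexander 1975 /
  GST 2013 Prop. 4.1.1 treat the fixed torus). It is therefore not vendored as a fact; the
  proposition is named (`ObjectiveHardSphereFlow.Existence`) for routes to file as an item.
* Ordered pairs `i < j` index contacts (with the image label `n`), so "exactly one contact" is
  the plain statement `i' = i ∧ j' = j ∧ n' = n`.
* Junk values: `F_t⁻¹` is `Matrix.inv` (zero when singular — only used inside `timeInterval A`);
  `reflectVel` at a zero separation vector is the identity (never at contact, `|s| = ε > 0`);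
  `det F_t ^ N` is clipped by `ENNReal.ofReal` (positive inside `timeInterval A`).

## References

* K. Dayal, R. D. James, *Nonequilibrium molecular dynamics for bulk materials and
  nanostructures*, J. Mech. Phys. Solids 58 (2010) 145–163, §3 (objective MD, invariant manifold),
  §4 (applications / flows). [DayalJames2010] (not held: acq-02615; locators per the route file.)
* R. D. James, A. Nota, J. J. L. Velázquez, *Long-time asymptotics for homoenergetic solutions of
  the Boltzmann equation: collision-dominated case*, J. Nonlinear Sci. 29 (2019), §1 pp. 2–3
  (the simulated/non-simulated atoms `y_{ν,k}(t) = y_k(t) + (I+tA)ν`, `det(I+tA) > 0` on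
  `[0, a)`, ansatz `f = g(t, v - A(I+tA)⁻¹x)`). [JamesNotaVelazquez2019] (read: arXiv:1808.06941.)
* D. J. Evans, G. P. Morriss, *Statistical Mechanics of Nonequilibrium Liquids*, 2nd ed. (2008),
  Ch. 6 (SLLOD equations `q̇ = p/m + q·∇u`, `ṗ = F - p·∇u`). [EvansMorriss2008]
* A. M. Kraynik, D. A. Reinelt, Int. J. Multiphase Flow 18 (1992) (compatible deforming lattices).
  [KraynikReinelt1992]
* I. Gallagher, L. Saint-Raymond, B. Texier, *From Newton to Boltzmann* (2013), §4.1 (trajectory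
  bookkeeping, Alexander's theorem on the fixed torus). [GST2013]
-/

open MeasureTheory Set Filter Topology
open scoped ENNReal InnerProductSpace

namespace Literature.Analysis.FluidPDE

noncomputable section

variable {d : Type*} {N : ℕ}

section Kinematics

variable [Fintype d] [DecidableEq d]

namespace Objective

/-! ## Homoenergetic kinematics -/

/-- The deformation gradient `F_t = I + tA` of the affine motion `x = F_t q` (Dayal–James 2010 §3;
JNV 2019 §1: images at `y_k + (I + tA)ν`). [cite: JamesNotaVelazquez2019, §1] -/
def defGrad (A : Matrix d d ℝ) (t : ℝ) : Matrix d d ℝ := 1 + t • A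

omit [Fintype d] in
/-- `F_0 = I`. [folklore] -/
@[simp]
theorem defGrad_zero (A : Matrix d d ℝ) : defGrad A 0 = 1 := by simp [defGrad]

omit [Fintype d] in
/-- For `A = 0` the cell does not deform: `F_t = I`. [folklore] -/
@[simp]
theorem defGrad_zero_matrix (t : ℝ) : defGrad (0 : Matrix d d ℝ) t = 1 := by simp [defGrad]

/-- The Eulerian velocity gradient `B_t = A F_t⁻¹` of the homoenergetic field `u(t, x) = B_t x`
(JNV 2019 §1: `f = g(t, v - A(I+tA)⁻¹x)`; `Ḃ = -B²`). `Matrix.inv` junk (`0`) where `F_t` is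
singular. [cite: JamesNotaVelazquez2019, §1] -/
def velGrad (A : Matrix d d ℝ) (t : ℝ) : Matrix d d ℝ := A * (defGrad A t)⁻¹

/-- `B_0 = A`. [folklore] -/
@[simp]
theorem velGrad_zero (A : Matrix d d ℝ) : velGrad A 0 = A := by simp [velGrad, inv_one]

/-- For `A = 0` there is no background flow: `B_t = 0`. [folklore] -/
@[simp]
theorem velGrad_zero_matrix (t : ℝ) : velGrad (0 : Matrix d d ℝ) t = 0 := by simp [velGrad]

/-- The maximal time interval of the homoenergetic flow around `0`: all `t` such that
`det F_s > 0` for every `s` between `0` and `t` (JNV 2019 §1: "a time interval `[0, a)` such that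
`det(I + tA) > 0`"; two-sided here, its right end point is `t*(A)`). [cite: JamesNotaVelazquez2019, §1] -/
def timeInterval (A : Matrix d d ℝ) : Set ℝ := {t | ∀ s ∈ uIcc 0 t, 0 < (defGrad A s).det}

/-- Membership in the time interval. [folklore] -/
theorem mem_timeInterval {A : Matrix d d ℝ} {t : ℝ} :
    t ∈ timeInterval A ↔ ∀ s ∈ uIcc 0 t, 0 < (defGrad A s).det :=
  Iff.rfl

/-- `0` belongs to the time interval. [folklore] -/
theorem zero_mem_timeInterval (A : Matrix d d ℝ) : (0 : ℝ) ∈ timeInterval A := by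
  intro s hs
  rw [uIcc_self, mem_singleton_iff] at hs
  simp [hs]

/-- For `A = 0` every time is admissible. [folklore] -/
@[simp]
theorem timeInterval_zero_matrix : timeInterval (0 : Matrix d d ℝ) = univ :=
  eq_univ_of_forall fun t s _ => by simp

/-- The physical separation vectors of the particle at cell position `x` from the periodic images
of the particle at cell position `y` at time `t`: `F_t (r + n)`, `n ∈ ℤᵈ`, with
`r = Torus.reprSym (x - y)` a lift of `x - y` (Dayal–James: images at `x_j + F_t n`). Which image
the label `n` designates depends on the lift; statements quantify over all `n`. [cite: DayalJames2010, §3] -/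
def imageSepVec (A : Matrix d d ℝ) (t : ℝ) (x y : UnitAddTorus d) (n : d → ℤ) :
    EuclideanSpace ℝ d :=
  Matrix.toEuclideanLin (defGrad A t) (Torus.reprSym (x - y) + FunctionSpaces.Torus.latticeVec n)

/-- The physical relative velocity of a particle with peculiar velocity `c` with respect to an
IMAGE, with peculiar velocity `c'`, at physical separation `s`: `w = c - c' + B_t s` (lab
velocities are `v = c + B_t x`, and the image of `j` displaced by `F_t n` moves with `v_j + A n`,
`A n = B_t F_t n`; Dayal–James §3). [cite: DayalJames2010, §3] -/
def relVel (A : Matrix d d ℝ) (t : ℝ) (s c c' : EuclideanSpace ℝ d) : EuclideanSpace ℝ d :=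
  c - c' + Matrix.toEuclideanLin (velGrad A t) s

/-- The hard-sphere domain of the objective dynamics at time `t`: no particle overlaps any image
of any particle, its own images included — `ε ≤ |F_t (r_{ij} + n)|` whenever `i ≠ j` or `n ≠ 0`
(closed constraint, contact included, as `hardSphereDomain`). Time dependent: the cell deforms.
[cite: DayalJames2010, §3] -/
def domain (A : Matrix d d ℝ) (ε : ℝ) (N : ℕ) (t : ℝ) : Set (Config N d (UnitAddTorus d)) :=
  {z | ∀ (i j : Fin N) (n : d → ℤ), (i ≠ j ∨ n ≠ 0) → ε ≤ ‖imageSepVec A t (z i).1 (z j).1 n‖}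

/-- Membership in the objective hard-sphere domain. [folklore] -/
theorem mem_domain {A : Matrix d d ℝ} {ε t : ℝ} {z : Config N d (UnitAddTorus d)} :
    z ∈ domain A ε N t ↔
      ∀ (i j : Fin N) (n : d → ℤ), (i ≠ j ∨ n ≠ 0) → ε ≤ ‖imageSepVec A t (z i).1 (z j).1 n‖ :=
  Iff.rfl

/-- The contact set of the ordered pair `(i, j)` through the image label `n` at time `t`:
configurations of the domain with `|F_t (r_{ij} + n)| = ε`. [cite: DayalJames2010, §3] -/
def contactSet (A : Matrix d d ℝ) (ε : ℝ) (N : ℕ) (t : ℝ) (i j : Fin N) (n : d → ℤ) :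
    Set (Config N d (UnitAddTorus d)) :=
  {z ∈ domain A ε N t | ‖imageSepVec A t (z i).1 (z j).1 n‖ = ε}

/-- Membership in a contact set. [folklore] -/
theorem mem_contactSet {A : Matrix d d ℝ} {ε t : ℝ} {i j : Fin N} {n : d → ℤ}
    {z : Config N d (UnitAddTorus d)} :
    z ∈ contactSet A ε N t i j n ↔
      z ∈ domain A ε N t ∧ ‖imageSepVec A t (z i).1 (z j).1 n‖ = ε :=
  Iff.rfl

/-- The contact `(i, j, n)` is *incoming* (pre-collisional) in `z` at time `t`: the physical
relative velocity points against the separation vector, `⟪s, w⟫ < 0`. [cite: DayalJames2010, §3] -/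
def IsIncoming (A : Matrix d d ℝ) (t : ℝ) (z : Config N d (UnitAddTorus d)) (i j : Fin N)
    (n : d → ℤ) : Prop :=
  ⟪imageSepVec A t (z i).1 (z j).1 n,
    relVel A t (imageSepVec A t (z i).1 (z j).1 n) (z i).2 (z j).2⟫_ℝ < 0

/-- The contact `(i, j, n)` is *outgoing* (post-collisional) in `z` at time `t`: `⟪s, w⟫ > 0`. [folklore] -/
def IsOutgoing (A : Matrix d d ℝ) (t : ℝ) (z : Config N d (UnitAddTorus d)) (i j : Fin N)
    (n : d → ℤ) : Prop :=
  0 < ⟪imageSepVec A t (z i).1 (z j).1 n,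
    relVel A t (imageSepVec A t (z i).1 (z j).1 n) (z i).2 (z j).2⟫_ℝ

/-- Free flight of the objective dynamics from time `s` to time `t` in cell coordinates:
`(q, c) ↦ (q + (t - s) F_t⁻¹ c, F_s F_t⁻¹ c)` — the particle moves on the straight line
`x(τ) = F_s q̃ + (τ - s)(c + A q̃) = F_τ q̃ + (τ - s) c` of `ℝᵈ`, rewritten through `q = F_τ⁻¹ x`,
`c = v - A F_τ⁻¹ x` (so `ċ = -B_τ c`: the force-free SLLOD equation). [cite: DayalJames2010, §3] -/
def freeFlight (A : Matrix d d ℝ) (s t : ℝ) (z : Config N d (UnitAddTorus d)) :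
    Config N d (UnitAddTorus d) :=
  fun i => ((z i).1 + FunctionSpaces.Torus.proj ((t - s) • Matrix.toEuclideanLin (defGrad A t)⁻¹ (z i).2),
    Matrix.toEuclideanLin (defGrad A s * (defGrad A t)⁻¹) (z i).2)

/-- Unfolding lemma for the objective free flight. [folklore] -/
@[simp]
theorem freeFlight_apply (A : Matrix d d ℝ) (s t : ℝ) (z : Config N d (UnitAddTorus d))
    (i : Fin N) :
    freeFlight A s t z i =
      ((z i).1 + FunctionSpaces.Torus.proj ((t - s) • Matrix.toEuclideanLin (defGrad A t)⁻¹ (z i).2),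
        Matrix.toEuclideanLin (defGrad A s * (defGrad A t)⁻¹) (z i).2) :=
  rfl

/-- The elastic collision of particle `i` with the image `n` of particle `j` at time `t`, in cell
coordinates: positions unchanged, and with `s = F_t (r_{ij} + n)`, `u = B_t s`,
`w = c_i - c_j + u`: `c_i' = c_i - (⟪w, s⟫/|s|²) s`, `c_j' = c_j + (⟪w, s⟫/|s|²) s` — i.e.
`reflectVel s` applied to the pair `(c_i, c_j - u)` of velocities seen from the frame of the
affine field at `x_i`, the offset `u` restored afterwards (Dayal–James §3: elastic collision of
particle and image with relative velocity `v_i - v_j - A n`). Meaningful for `i ≠ j`. [cite: DayalJames2010, §3] -/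
def collide (A : Matrix d d ℝ) (t : ℝ) (i j : Fin N) (n : d → ℤ)
    (z : Config N d (UnitAddTorus d)) : Config N d (UnitAddTorus d) :=
  Function.update (Function.update z i
    ((z i).1, (reflectVel (imageSepVec A t (z i).1 (z j).1 n) ((z i).2, (z j).2 -
      Matrix.toEuclideanLin (velGrad A t) (imageSepVec A t (z i).1 (z j).1 n))).1)) j
    ((z j).1, (reflectVel (imageSepVec A t (z i).1 (z j).1 n) ((z i).2, (z j).2 -
      Matrix.toEuclideanLin (velGrad A t) (imageSepVec A t (z i).1 (z j).1 n))).2 +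
      Matrix.toEuclideanLin (velGrad A t) (imageSepVec A t (z i).1 (z j).1 n))

variable {A : Matrix d d ℝ} {t : ℝ} {i j : Fin N} {n : d → ℤ}

/-- After the collision `(i, j, n)`, particle `i` keeps its position and gets `c_i'`. [folklore] -/
theorem collide_apply_left (hij : i ≠ j) (z : Config N d (UnitAddTorus d)) :
    collide A t i j n z i =
      ((z i).1, (reflectVel (imageSepVec A t (z i).1 (z j).1 n) ((z i).2, (z j).2 -
        Matrix.toEuclideanLin (velGrad A t) (imageSepVec A t (z i).1 (z j).1 n))).1) := by
  simp [collide, Function.update_of_ne hij]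

/-- After the collision `(i, j, n)`, particle `j` keeps its position and gets `c_j'`. [folklore] -/
theorem collide_apply_right (z : Config N d (UnitAddTorus d)) :
    collide A t i j n z j =
      ((z j).1, (reflectVel (imageSepVec A t (z i).1 (z j).1 n) ((z i).2, (z j).2 -
        Matrix.toEuclideanLin (velGrad A t) (imageSepVec A t (z i).1 (z j).1 n))).2 +
        Matrix.toEuclideanLin (velGrad A t) (imageSepVec A t (z i).1 (z j).1 n)) := by
  simp [collide]

/-- Particles other than `i, j` are unaffected by the collision `(i, j, n)`. [folklore] -/
theorem collide_apply_of_ne {k : Fin N} (hki : k ≠ i) (hkj : k ≠ j)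
    (z : Config N d (UnitAddTorus d)) : collide A t i j n z k = z k := by
  simp [collide, Function.update_of_ne hki, Function.update_of_ne hkj]

/-- A collision does not move the particles. [folklore] -/
@[simp]
theorem collide_apply_fst (z : Config N d (UnitAddTorus d)) (k : Fin N) :
    (collide A t i j n z k).1 = (z k).1 := by
  by_cases hkj : k = j
  · subst hkj; rw [collide_apply_right]
  by_cases hki : k = i
  · subst hki; rw [collide_apply_left hkj]
  rw [collide_apply_of_ne hki hkj]

/-! ### `A = 0`: the kinematics of `HardSpherePhaseSpace` on the flat torus -/

/-- For `A = 0` the separation vector through the label `n = 0` is the minimal-image separation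
vector of `Torus.geometry d`. [folklore] -/
@[simp]
theorem imageSepVec_zero_matrix_zero (t : ℝ) (x y : UnitAddTorus d) :
    imageSepVec (0 : Matrix d d ℝ) t x y 0 = (Torus.geometry d).sepVec x y := by
  simp [imageSepVec]

/-- For `A = 0` the relative velocity is `c - c'`. [folklore] -/
@[simp]
theorem relVel_zero_matrix (t : ℝ) (s c c' : EuclideanSpace ℝ d) :
    relVel (0 : Matrix d d ℝ) t s c c' = c - c' := by
  simp [relVel]

/-- For `A = 0` the objective free flight from `s` to `t` is the free flight of `Torus.geometry d`
for time `t - s`. [folklore] -/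
theorem freeFlight_zero_matrix (s t : ℝ) (z : Config N d (UnitAddTorus d)) :
    freeFlight (0 : Matrix d d ℝ) s t z = FluidPDE.freeFlight (Torus.geometry d) (t - s) z := by
  funext i
  simp [inv_one]

/-- For `A = 0` the objective collision through the label `n = 0` is the binary elastic collision
`collidePair` of `Torus.geometry d`. [folklore] -/
theorem collide_zero_matrix (t : ℝ) (i j : Fin N) (z : Config N d (UnitAddTorus d)) :
    collide (0 : Matrix d d ℝ) t i j 0 z = collidePair (Torus.geometry d) i j z := by
  simp only [collide, collidePair, velGrad_zero_matrix, map_zero, LinearMap.zero_apply, sub_zero,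
    add_zero, imageSepVec_zero_matrix_zero]

/-- For `A = 0` the contact `(i, j, 0)` is incoming iff the pair `(i, j)` is incoming in the sense of
`HardSpherePhaseSpace`. [folklore] -/
theorem isIncoming_zero_matrix_iff (t : ℝ) (z : Config N d (UnitAddTorus d)) (i j : Fin N) :
    IsIncoming (0 : Matrix d d ℝ) t z i j 0 ↔ FluidPDE.IsIncoming (Torus.geometry d) z i j := by
  simp [IsIncoming, FluidPDE.IsIncoming]

/-! ## Collision times and the Liouville measures -/

/-- The collision (contact) times of a curve `γ` in phase space: times at which some ordered pair
`i < j` is in contact through some image. [cite: DayalJames2010, §3] -/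
def collisionTimes (A : Matrix d d ℝ) (ε : ℝ) (γ : ℝ → Config N d (UnitAddTorus d)) : Set ℝ :=
  {t | ∃ (i j : Fin N) (n : d → ℤ), i < j ∧ γ t ∈ contactSet A ε N t i j n}

/-- Membership in the set of collision times. [folklore] -/
theorem mem_collisionTimes {A : Matrix d d ℝ} {ε : ℝ} {γ : ℝ → Config N d (UnitAddTorus d)}
    {t : ℝ} :
    t ∈ collisionTimes A ε γ ↔ ∃ (i j : Fin N) (n : d → ℤ), i < j ∧ γ t ∈ contactSet A ε N t i j n :=
  Iff.rfl

/-- The number of collisions of `γ` in the window `[a, b]` (`Set.ncard`: junk `0` if infinite). [folklore] -/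
def numCollisions (A : Matrix d d ℝ) (ε : ℝ) (γ : ℝ → Config N d (UnitAddTorus d)) (a b : ℝ) :
    ℕ :=
  (collisionTimes A ε γ ∩ Icc a b).ncard

/-- The Liouville measure of the objective dynamics at time `t`: `(det F_t)^N · dq dc` restricted
to the domain at time `t` — the image of Lebesgue measure `dx dv` of the `N` simulated atoms
under `x = F_t q`, `v = c + A q` (Jacobian `det F_t` per particle). The flow pushes the time-`s`
measure to the time-`t` measure (`ObjectiveHardSphereFlow.measurePreserving`). `ENNReal.ofReal`
clips a nonpositive determinant (outside `timeInterval A`) to `0`. [cite: DayalJames2010, §4] -/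
def liouville (A : Matrix d d ℝ) (ε : ℝ) (N : ℕ) (t : ℝ) :
    Measure (Config N d (UnitAddTorus d)) :=
  ENNReal.ofReal ((defGrad A t).det ^ N) • volume.restrict (domain A ε N t)

/-- Unfolding lemma for the objective Liouville measure. [folklore] -/
theorem liouville_eq (A : Matrix d d ℝ) (ε : ℝ) (N : ℕ) (t : ℝ) :
    liouville A ε N t =
      ENNReal.ofReal ((defGrad A t).det ^ N) • volume.restrict (domain A ε N t) :=
  rfl

end Objective

/-! ## Objective hard-sphere trajectories -/

/-- `γ : ℝ → Config N d 𝕋ᵈ` is a trajectory of the OBJECTIVE hard-sphere dynamics with matrix `A`,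
diameter `ε`, on the time window `[0, T]` (values outside the window are irrelevant): it stays in
the time-dependent domain, has finitely many collision times in `[0, T]`, continuous positions,
is objective free flight on every collision-free `(s, t] ⊆ [0, T]`, and at each collision time
`t ∈ (0, T]` there is exactly ONE contact `(i, j, n)` (`i < j`; no multiple or simultaneous image
contacts), the left limit exists and is pre-collisional, and `γ t` is its elastic image
(right-continuity) — the bookkeeping of `IsHardSphereTrajectory` (GST 2013 §4.1) for the
Dayal–James dynamics. [cite: DayalJames2010, §3] -/
structure IsObjectiveHSTrajectory (A : Matrix d d ℝ) (ε : ℝ) (N : ℕ) (T : ℝ)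
    (γ : ℝ → Config N d (UnitAddTorus d)) : Prop where
  /-- The trajectory stays in the (time-dependent) domain. -/
  mem : ∀ t ∈ Icc 0 T, γ t ∈ Objective.domain A ε N t
  /-- Finitely many collision times in the window. -/
  locFinite : (Objective.collisionTimes A ε γ ∩ Icc 0 T).Finite
  /-- Positions are continuous on the window. -/
  pos_continuousOn : ∀ i, ContinuousOn (fun t => (γ t i).1) (Icc 0 T)
  /-- Objective free flight on collision-free intervals `(s, t] ⊆ [0, T]`. -/
  free : ∀ s t, 0 ≤ s → s ≤ t → t ≤ T → (∀ τ ∈ Ioc s t, τ ∉ Objective.collisionTimes A ε γ) →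
    γ t = Objective.freeFlight A s t (γ s)
  /-- At a collision time exactly one contact occurs, from a pre-collisional left limit, and the
  jump is the elastic law. -/
  binary : ∀ t ∈ Ioc 0 T, ∀ (i j : Fin N) (n : d → ℤ), i < j →
    γ t ∈ Objective.contactSet A ε N t i j n →
    (∀ (i' j' : Fin N) (n' : d → ℤ), i' < j' → γ t ∈ Objective.contactSet A ε N t i' j' n' →
      i' = i ∧ j' = j ∧ n' = n) ∧
    ∃ zl, Tendsto γ (𝓝[<] t) (𝓝 zl) ∧ Objective.IsIncoming A t zl i j n ∧
      γ t = Objective.collide A t i j n zl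

namespace IsObjectiveHSTrajectory

variable {A : Matrix d d ℝ} {ε T : ℝ} {γ : ℝ → Config N d (UnitAddTorus d)}

/-- On an objective trajectory the number of collisions in the window is the cardinality of the
finite set of collision times. [folklore] -/
theorem numCollisions_eq (h : IsObjectiveHSTrajectory A ε N T γ) :
    Objective.numCollisions A ε γ 0 T = h.locFinite.toFinset.card := by
  rw [Objective.numCollisions, Set.ncard_eq_toFinset_card _ h.locFinite]

/-- Restriction to a shorter window. [folklore] -/
theorem mono (h : IsObjectiveHSTrajectory A ε N T γ) {T' : ℝ} (hT' : T' ≤ T) :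
    IsObjectiveHSTrajectory A ε N T' γ where
  mem t ht := h.mem t ⟨ht.1, ht.2.trans hT'⟩
  locFinite := h.locFinite.subset (inter_subset_inter_right _ (Icc_subset_Icc_right hT'))
  pos_continuousOn i := (h.pos_continuousOn i).mono (Icc_subset_Icc_right hT')
  free s t hs hst ht := h.free s t hs hst (ht.trans hT')
  binary t ht := h.binary t ⟨ht.1, ht.2.trans hT'⟩

end IsObjectiveHSTrajectory

/-! ## The objective hard-sphere flow (hypothesis structure) -/

/-- **The objective (Dayal–James) hard-sphere flow** with matrix `A`, diameter `ε`, `N` particles,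
on the time window `[0, T]`, bundled with its defining properties — the analogue of
`HardSphereFlow` for the non-autonomous objective dynamics: two-time flow maps `flow s t`
(state at time `s` ↦ state at time `t`), measurable good sets `good t ⊆ domain t` of full
`Objective.liouville A ε N t`-measure, mapped into each other, `flow s s = id` and the cocycle
`flow t u ∘ flow s t = flow s u` on good points (all `s, t, u ∈ [0, T]`, any order — so
`flow t s` inverts `flow s t`), each `flow s t` measurable, orbits of good time-`0` data are
objective hard-sphere trajectories on `[0, T]`, and `flow s t` pushes the time-`s` Liouville
measure to the time-`t` one (Liouville's theorem for the image-symmetric Newtonian dynamics,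
Dayal–James §3–4). Outside the good sets / the window the values of `flow` are junk. Existence
is NOT part of the structure (`ObjectiveHardSphereFlow.Existence`). [cite: DayalJames2010, §3–4] -/
structure ObjectiveHardSphereFlow (A : Matrix d d ℝ) (ε : ℝ) (N : ℕ) (T : ℝ) where
  /-- The two-time flow map `(s, t, z) ↦ Φ_{s,t} z`. -/
  flow : ℝ → ℝ → Config N d (UnitAddTorus d) → Config N d (UnitAddTorus d)
  /-- The good sets of time-`t` states on which the dynamics is globally defined on `[0, T]`. -/
  good : ℝ → Set (Config N d (UnitAddTorus d))
  /-- Good sets are measurable. -/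
  measurableSet_good : ∀ t ∈ Icc 0 T, MeasurableSet (good t)
  /-- Good sets lie in the domain. -/
  good_subset : ∀ t ∈ Icc 0 T, good t ⊆ Objective.domain A ε N t
  /-- Good sets have full Liouville measure. -/
  measure_compl_good : ∀ t ∈ Icc 0 T, Objective.liouville A ε N t (good t)ᶜ = 0
  /-- The flow maps good sets to good sets. -/
  mapsTo_good : ∀ s ∈ Icc 0 T, ∀ t ∈ Icc 0 T, MapsTo (flow s t) (good s) (good t)
  /-- `Φ_{s,s} = id` on the good set. -/
  flow_self : ∀ s ∈ Icc 0 T, ∀ z ∈ good s, flow s s z = z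
  /-- The cocycle (two-time group) property `Φ_{t,u} ∘ Φ_{s,t} = Φ_{s,u}` on the good set. -/
  flow_flow : ∀ s ∈ Icc 0 T, ∀ t ∈ Icc 0 T, ∀ u ∈ Icc 0 T, ∀ z ∈ good s,
    flow t u (flow s t z) = flow s u z
  /-- Each map `Φ_{s,t}` is measurable. -/
  measurable_flow : ∀ s ∈ Icc 0 T, ∀ t ∈ Icc 0 T, Measurable (flow s t)
  /-- Orbits of good initial data are objective hard-sphere trajectories on `[0, T]`. -/
  isTrajectory : ∀ z ∈ good 0, IsObjectiveHSTrajectory A ε N T fun t => flow 0 t z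
  /-- `Φ_{s,t}` pushes the time-`s` Liouville measure to the time-`t` one. -/
  measurePreserving : ∀ s ∈ Icc 0 T, ∀ t ∈ Icc 0 T,
    MeasurePreserving (flow s t) (Objective.liouville A ε N s) (Objective.liouville A ε N t)

namespace ObjectiveHardSphereFlow

variable {A : Matrix d d ℝ} {ε T : ℝ}

/-- At every time of the window, Liouville-almost every state is good. [folklore] -/
theorem ae_mem_good (Φ : ObjectiveHardSphereFlow A ε N T) {t : ℝ} (ht : t ∈ Icc 0 T) :
    ∀ᵐ z ∂Objective.liouville A ε N t, z ∈ Φ.good t :=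
  Φ.measure_compl_good t ht

/-- `Φ_{t,s}` inverts `Φ_{s,t}` on the good set. [folklore] -/
theorem flow_flow_symm (Φ : ObjectiveHardSphereFlow A ε N T) {s t : ℝ} (hs : s ∈ Icc 0 T)
    (ht : t ∈ Icc 0 T) {z : Config N d (UnitAddTorus d)} (hz : z ∈ Φ.good s) :
    Φ.flow t s (Φ.flow s t z) = z := by
  rw [Φ.flow_flow s hs t ht s hs z hz, Φ.flow_self s hs z hz]

/-- Good orbits stay in the domain. [folklore] -/
theorem flow_mem_domain (Φ : ObjectiveHardSphereFlow A ε N T) {s t : ℝ} (hs : s ∈ Icc 0 T)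
    (ht : t ∈ Icc 0 T) {z : Config N d (UnitAddTorus d)} (hz : z ∈ Φ.good s) :
    Φ.flow s t z ∈ Objective.domain A ε N t :=
  Φ.good_subset t ht (Φ.mapsTo_good s hs t ht hz)

/-- The law at time `t` of the objective system started at time `0` from the law `P₀`:
`(Φ_{0,t})_* P₀`. [folklore] -/
def lawAt (Φ : ObjectiveHardSphereFlow A ε N T) (P₀ : Measure (Config N d (UnitAddTorus d)))
    (t : ℝ) : Measure (Config N d (UnitAddTorus d)) :=
  P₀.map (Φ.flow 0 t)

/-- Unfolding lemma for `lawAt`. [folklore] -/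
@[simp]
theorem lawAt_eq (Φ : ObjectiveHardSphereFlow A ε N T) (P₀ : Measure (Config N d (UnitAddTorus d)))
    (t : ℝ) : Φ.lawAt P₀ t = P₀.map (Φ.flow 0 t) := rfl

/-- Liouville's theorem restated: the time-`0` Liouville measure is transported to the time-`t`
one. [folklore] -/
theorem lawAt_liouville (Φ : ObjectiveHardSphereFlow A ε N T) {t : ℝ} (ht : t ∈ Icc 0 T) :
    Φ.lawAt (Objective.liouville A ε N 0) t = Objective.liouville A ε N t :=
  (Φ.measurePreserving 0 ⟨le_rfl, ht.1.trans ht.2⟩ t ht).map_eq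

/-- The transport of a real observable/density from time `t` back to time `0`:
`(S_t F)(z) = F (Φ_{t,0} z)`. [folklore] -/
def transportFn (Φ : ObjectiveHardSphereFlow A ε N T) (F : Config N d (UnitAddTorus d) → ℝ)
    (t : ℝ) : Config N d (UnitAddTorus d) → ℝ :=
  fun z => F (Φ.flow t 0 z)

/-- Unfolding lemma for `transportFn`. [folklore] -/
@[simp]
theorem transportFn_apply (Φ : ObjectiveHardSphereFlow A ε N T)
    (F : Config N d (UnitAddTorus d) → ℝ) (t : ℝ) (z : Config N d (UnitAddTorus d)) :
    Φ.transportFn F t z = F (Φ.flow t 0 z) := rfl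

/-- NO SPHERES (`N = 0`): the identity maps form an objective hard-sphere flow for any `A, ε, T`
(a degenerate but honest inhabitant; for `N = 0` all Liouville measures have density
`(det F_t)^0 = 1`). [folklore] -/
def zero (A : Matrix d d ℝ) (ε T : ℝ) : ObjectiveHardSphereFlow A ε 0 T where
  flow _ _ z := z
  good _ := univ
  measurableSet_good _ _ := MeasurableSet.univ
  good_subset _ _ z _ := fun i => Fin.elim0 i
  measure_compl_good _ _ := by simp
  mapsTo_good _ _ _ _ := mapsTo_univ _ _
  flow_self _ _ _ _ := rfl
  flow_flow _ _ _ _ _ _ _ _ := rfl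
  measurable_flow _ _ _ _ := measurable_id
  isTrajectory z _ :=
    { mem := fun _ _ i => Fin.elim0 i
      locFinite := Set.finite_empty.subset (by
        rintro t ⟨⟨i, -⟩, -⟩
        exact Fin.elim0 i)
      pos_continuousOn := fun i => Fin.elim0 i
      free := fun _ _ _ _ _ _ => funext fun i => Fin.elim0 i
      binary := fun _ _ i => Fin.elim0 i }
  measurePreserving s _ t _ := by
    have h : Objective.liouville A ε 0 s = Objective.liouville A ε 0 t := by
      simp only [Objective.liouville, pow_zero, ENNReal.ofReal_one, one_smul]
      congr 1
      ext z
      simp [Objective.mem_domain]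
    rw [h]
    exact MeasurePreserving.id _

/-- **Existence of the objective hard-sphere flow (the Alexander-type STATEMENT).** For the
parameters `(A, ε, N, T)`: the structure is inhabited, i.e. outside Liouville-null sets of data
the Dayal–James dynamics is globally defined on `[0, T]` with finitely many, binary, non-grazing
collisions, measurably, transporting the Liouville measures. This is the DEFINITION of the
proposition, for routes to file as an item with their hypotheses (`Icc 0 T ⊆ timeInterval A`,
a cell that stays thicker than `ε`, small reduced density); it is not a vendored fact — no such
theorem is in print for deforming cells (Alexander 1975 / GST 2013 Prop. 4.1.1: fixed torus;
Dayal–James 2010 §3: smooth forces). [folklore] -/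
def Existence (A : Matrix d d ℝ) (ε : ℝ) (N : ℕ) (T : ℝ) : Prop :=
  Nonempty (ObjectiveHardSphereFlow A ε N T)

/-- The degenerate case `N = 0` of the existence statement holds (`zero`). [folklore] -/
theorem existence_zero (A : Matrix d d ℝ) (ε T : ℝ) : Existence A ε 0 T :=
  ⟨zero A ε T⟩

end ObjectiveHardSphereFlow

/-! ## The canonical Gibbs datum and the peculiar kinetic tensor -/

/-- The unnormalised canonical Gibbs weight at time `0` and temperature `θ₀`: the indicator of the
time-`0` domain (non-overlapping positions in the unit cell, all images) times the product of
Maxwellian weights `exp (-|c_i|²/(2θ₀))` of the PECULIAR velocities — lab velocities are then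
Maxwellian about the affine field `u = A x` (`F_0 = I`, `B_0 = A`). [cite: DayalJames2010, §4] -/
def objectiveGibbsWeight (A : Matrix d d ℝ) (ε : ℝ) (N : ℕ) (θ₀ : ℝ)
    (z : Config N d (UnitAddTorus d)) : ℝ :=
  (Objective.domain A ε N 0).indicator (fun z => ∏ i, Real.exp (-‖(z i).2‖ ^ 2 / (2 * θ₀))) z

/-- The canonical partition function of the Gibbs datum: `∫ objectiveGibbsWeight dq dc`. [folklore] -/
def objectiveGibbsPartition (A : Matrix d d ℝ) (ε : ℝ) (N : ℕ) (θ₀ : ℝ) : ℝ :=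
  ∫ z, objectiveGibbsWeight A ε N θ₀ z

/-- The canonical Gibbs density at time `0` (w.r.t. `dq dc`): normalised `objectiveGibbsWeight`
(junk `0` if the partition function vanishes, as `canonicalDensity`). [cite: DayalJames2010, §4] -/
def objectiveGibbsDensity (A : Matrix d d ℝ) (ε : ℝ) (N : ℕ) (θ₀ : ℝ)
    (z : Config N d (UnitAddTorus d)) : ℝ :=
  (objectiveGibbsPartition A ε N θ₀)⁻¹ * objectiveGibbsWeight A ε N θ₀ z

/-- **The canonical Gibbs datum of objective MD** `objectiveGibbsLaw A ε N θ₀`: the probability law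
on time-`0` states with density `objectiveGibbsDensity` w.r.t. Lebesgue measure `dq dc` — uniform
non-overlapping positions in the unit cell × i.i.d. Maxwellian peculiar velocities at temperature
`θ₀` (the homogeneous local-equilibrium state carried by the homoenergetic flow; its law at time
`t` under a flow `Φ` is `Φ.lawAt (objectiveGibbsLaw A ε N θ₀) t`). In cell coordinates it does not
depend on `A` (`F_0 = I`). [cite: DayalJames2010, §4] -/
def objectiveGibbsLaw (A : Matrix d d ℝ) (ε : ℝ) (N : ℕ) (θ₀ : ℝ) :
    Measure (Config N d (UnitAddTorus d)) :=
  volume.withDensity fun z => ENNReal.ofReal (objectiveGibbsDensity A ε N θ₀ z)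

/-- The Gibbs weight is nonnegative. [folklore] -/
theorem objectiveGibbsWeight_nonneg (A : Matrix d d ℝ) (ε : ℝ) (N : ℕ) (θ₀ : ℝ)
    (z : Config N d (UnitAddTorus d)) : 0 ≤ objectiveGibbsWeight A ε N θ₀ z := by
  unfold objectiveGibbsWeight
  exact Set.indicator_nonneg (fun _ _ => Finset.prod_nonneg fun _ _ => (Real.exp_pos _).le) z

/-- The Gibbs weight vanishes off the time-`0` domain. [folklore] -/
theorem objectiveGibbsWeight_eq_zero {A : Matrix d d ℝ} {ε θ₀ : ℝ}
    {z : Config N d (UnitAddTorus d)} (hz : z ∉ Objective.domain A ε N 0) :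
    objectiveGibbsWeight A ε N θ₀ z = 0 :=
  Set.indicator_of_notMem hz _

end Kinematics

section Tensor

variable {X : Type*}

/-- The EMPIRICAL KINETIC TENSOR `N⁻¹ ∑ᵢ vᵢ ⊗ vᵢ` of a configuration (entries
`N⁻¹ ∑ᵢ v_{i,k} v_{i,l}`). On the objective phase space the velocities ARE the peculiar velocities
`cᵢ`, so this is the peculiar kinetic (pressure) tensor of SLLOD dynamics; its trace over `d` is
the kinetic temperature (`empiricalTemperature`). `0` for `N = 0`. [folklore] -/
def empiricalKineticTensor (z : Config N d X) : Matrix d d ℝ :=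
  Matrix.of fun k l => (N : ℝ)⁻¹ * ∑ i, (z i).2 k * (z i).2 l

/-- Entries of the empirical kinetic tensor. [folklore] -/
@[simp]
theorem empiricalKineticTensor_apply (z : Config N d X) (k l : d) :
    empiricalKineticTensor z k l = (N : ℝ)⁻¹ * ∑ i, (z i).2 k * (z i).2 l := rfl

/-- The empirical kinetic tensor is symmetric. [folklore] -/
theorem empiricalKineticTensor_transpose (z : Config N d X) :
    (empiricalKineticTensor z).transpose = empiricalKineticTensor z := by
  ext k l
  simp [mul_comm]

/-- The empirical kinetic tensor as a second moment of the empirical measure: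
`T_{kl}(z) = ∫ v_k v_l dμ_z` (the form used in the route `HomoenergeticRung`). [folklore] -/
theorem empiricalKineticTensor_eq_integral [Fintype d] [MeasurableSpace X] [MeasurableSingletonClass X]
    (z : Config N d X) (k l : d) :
    empiricalKineticTensor z k l = ∫ y, y.2 k * y.2 l ∂empiricalMeasure z := by
  rw [empiricalKineticTensor_apply, integral_empiricalMeasure]

/-- The kinetic temperature `(d N)⁻¹ ∑ᵢ |vᵢ|²` of a configuration (peculiar temperature on the
objective phase space) is the normalised trace of the kinetic tensor. [folklore] -/
def empiricalTemperature [Fintype d] (z : Config N d X) : ℝ :=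
  (Fintype.card d : ℝ)⁻¹ * (empiricalKineticTensor z).trace

/-- The kinetic temperature in terms of the kinetic energy `configEnergy = ½ ∑ |vᵢ|²`:
`θ(z) = 2 configEnergy z / (d N)`. [folklore] -/
theorem empiricalTemperature_eq [Fintype d] (z : Config N d X) :
    empiricalTemperature z = 2 * configEnergy z / (Fintype.card d * N) := by
  simp only [empiricalTemperature, Matrix.trace, Matrix.diag, empiricalKineticTensor_apply,
    configEnergy, EuclideanSpace.norm_eq, Real.norm_eq_abs, sq_abs]
  rw [← Finset.mul_sum, Finset.sum_comm]
  have h : ∀ i : Fin N, Real.sqrt (∑ k, (z i).2 k ^ 2) ^ 2 = ∑ k, (z i).2 k * (z i).2 k :=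
    fun i => by
      rw [Real.sq_sqrt (Finset.sum_nonneg fun _ _ => sq_nonneg _)]
      exact Finset.sum_congr rfl fun _ _ => sq _
  simp_rw [h]
  field_simp

end Tensor

end

end Literature.Analysis.FluidPDE
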